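import Literature.Computability.AlgebraicComplexity.QuantumFunctionalsUpperKroneckerProofs
import Literature.NumberTheory.DiophantineGeometry.SymmetricGroupRepsKroneckerCharacterProofs
import Literature.NumberTheory.DiophantineGeometry.SymmetricGroupRepsFinrankSpechtProofs
import Mathlib.LinearAlgebra.Trace
import HarnessLib

/-!
# The Kronecker restriction rule: discharge of `kroneckerCoeff_ne_zero_of_isotypicSum_outerPow`
# (CVZ §3.1, the paragraph before Lemma 3.13)

Topic `Literature/Computability/AlgebraicComplexity`; proofs file for the named fact
`kroneckerCoeff_ne_zero_of_isotypicSum_outerPow` of `QuantumFunctionalsUpperKronecker.lean`: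
"the projections `P_λ^{V⊗W}` and `P_μ^V ⊗ P_ν^W` commute, and their product is nonzero (only)
if the Kronecker coefficient `g_{λ,μ,ν}` is nonzero" (Christandl–Vrana–Zuiddam, J. Amer. Math.
Soc. 36 (2023), §3.1, before Lemma 3.13), in the coordinates of the tree
(`isotypicSumⱼ λ (isotypicSumⱼ μ u ⊗ isotypicSumⱼ ν v) ≠ 0 ⇒ kroneckerCoeff ℂ μ ν λ ≠ 0`).

## Proof (characters; Serre §2.6 and Fulton–Harris Ex. 4.51)

Everything is reduced to the tree's character theory of finite groups
(`Literature/RepresentationTheory/FiniteGroups/`): Serre's isotypic projectors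
`P_χ = (χ(1)/|G|) ∑_t χ(t) ρ(t⁻¹)` (`isotypicProj`, with `P_χ² = P_χ`, `P_χ P_χ' = 0`,
`tr P_χ = χ(1)⟨χ, χ_ρ⟩`), the Fourier expansion of class functions
(`IsClassFun.eq_sum_classInner_smul`) and, for `𝔖ₙ`, `irrChars = {χ^μ}`
(`SymmetricGroupIsotypic.lean`), together with the character formula
`n!·g = ∑_σ χ^λ χ^μ χ^ν` (`kroneckerCoeff_eq_sum_spechtCharacter_holds`).

1. `trace_comp_isotypicProj_specht`: for every finite-dimensional representation `ρ` of `𝔖ₙ`,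
   `tr(ρ(h) P_μ) = ⟨χ^μ, χ_ρ⟩ χ^μ(h)` — the function `h ↦ tr(ρ(h) P_μ)` is a class function whose
   Fourier coefficient at `χ^ν` is `tr(P_ν P_μ)/χ^ν(1) = δ_{νμ} ⟨χ^μ, χ_ρ⟩`.
2. `kroneckerCoeff_ne_zero_of_isotypicProj_bilin` (abstract form of the rule): for
   representations `ρ₁, ρ₂, ρ` of `𝔖ₙ` and an equivariant bilinear map `B` (`B(gx, gy) = g B(x,y)`),
   if `P_λ^ρ B(P_μ x, P_ν y) ≠ 0` then `g(μ, ν; λ) ≠ 0`: on `V₁ ⊗ V₂` the operator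
   `E = P_λ^{ρ₁⊗ρ₂} ∘ (P_μ ⊗ P_ν)` is a nonzero idempotent (the factors commute), so
   `0 ≠ tr E = (χ^λ(1)/n!) ∑_t χ^λ(t) tr(ρ₁(t⁻¹)P_μ) tr(ρ₂(t⁻¹)P_ν)
          = (χ^λ(1)/n!) ⟨χ^μ,χ₁⟩⟨χ^ν,χ₂⟩ ∑_t χ^λ(t) χ^μ(t) χ^ν(t) = χ^λ(1)⟨χ^μ,χ₁⟩⟨χ^ν,χ₂⟩ · g`.
3. The coordinate statement for alphabets in `Type` (`…_type`): the leg representations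
   `permLegsRepⱼ` (for which `P_λ = (χ_λ(1)/n!) • isotypicSumⱼ λ`) and the bilinear map `outerPow`,
   which carries the diagonal action; then all universes by re-indexing the alphabets
   (`reindexPow`, `QuantumFunctionalsUpperKroneckerProofs.lean`):
   `kroneckerCoeff_ne_zero_of_isotypicSum_outerPow_holds`.

## References

* M. Christandl, P. Vrana, J. Zuiddam, J. Amer. Math. Soc. 36 (2023) = arXiv:1709.07851v3,
  §3.1 (before Lemma 3.13), Def. 3.8. [ChristandlVranaZuiddam2023]
* J.-P. Serre, *Linear Representations of Finite Groups*, GTM 42, §2.6 Thm. 8, §2.5 Thm. 6.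
  [SerreLinearRepresentations1977]
* W. Fulton, J. Harris, *Representation Theory*, GTM 129, Ex. 4.51 (a). [FultonHarrisGTM129]
-/

noncomputable section

open scoped BigOperators TensorProduct

namespace Literature.Computability.AlgebraicComplexity

open Literature.NumberTheory.DiophantineGeometry (spechtCharacter spechtRep spechtIdeal kroneckerCoeff
  finrank_spechtIdeal_holds numStandardTableaux_pos_holds kroneckerCoeff_eq_sum_spechtCharacter_holds)
open Literature.RepresentationTheory.FiniteGroups

universe u

/-! ## §1 `tr(ρ(h) P_μ) = ⟨χ^μ, χ_ρ⟩ χ^μ(h)` -/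

section Trace

variable {n : ℕ}

/-- `χ^μ(1) = f^μ ≠ 0` (the Specht module `S^μ` has positive dimension, the number of standard
tableaux of shape `μ`). [folklore] -/
theorem spechtCharacter_one_ne_zero (μ : Nat.Partition n) : spechtCharacter ℂ μ 1 ≠ 0 := by
  rw [show spechtCharacter ℂ μ 1 = (Module.finrank ℂ (spechtIdeal ℂ μ) : ℂ) from
    Representation.char_one _, finrank_spechtIdeal_holds ℂ μ, Nat.cast_ne_zero]
  exact (numStandardTableaux_pos_holds μ).ne'

/-- The Specht characters are class functions. [folklore] -/
theorem isClassFun_spechtCharacter (μ : Nat.Partition n) : IsClassFun (spechtCharacter ℂ μ) :=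
  (isIrrChar_spechtCharacter μ).isCharacter.isClassFun

variable {V : Type*} [AddCommGroup V] [Module ℂ V]

/-- Serre's endomorphism is linear in the class function: `ρ_{c f} = c ρ_f`. [folklore] -/
theorem weightedSum_smul (ρ : Representation ℂ (Equiv.Perm (Fin n)) V) (c : ℂ)
    (f : Equiv.Perm (Fin n) → ℂ) :
    Representation.weightedSum ρ (c • f) = c • Representation.weightedSum ρ f := by
  simp only [Representation.weightedSum, Pi.smul_apply, smul_eq_mul, mul_smul, Finset.smul_sum]

/-- `∑_s χ^ν(s⁻¹) ρ(s) = ρ_{χ^ν} = (n!/χ^ν(1)) P_ν`, in the form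
`(χ^ν(1)/n!) • ∑_s χ^ν(s⁻¹) ρ(s) = P_ν`. [cite: SerreLinearRepresentations1977, §2.6 Thm. 8] -/
theorem smul_sum_spechtCharacter_inv_smul_eq_isotypicProj (ρ : Representation ℂ (Equiv.Perm (Fin n)) V)
    (ν : Nat.Partition n) :
    (spechtCharacter ℂ ν 1 / (n.factorial : ℂ)) •
        ∑ s : Equiv.Perm (Fin n), spechtCharacter ℂ ν s⁻¹ • ρ s =
      isotypicProj ρ (spechtCharacter ℂ ν) := by
  have hW : ∑ s : Equiv.Perm (Fin n), spechtCharacter ℂ ν s⁻¹ • ρ s =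
      Representation.weightedSum ρ (spechtCharacter ℂ ν) := by
    rw [Representation.weightedSum]
    exact Fintype.sum_equiv (Equiv.inv _) _ _ fun s => by simp
  rw [hW, isotypicProj, weightedSum_smul, card_perm_fin_cast]

/-- **`tr(ρ(h) P_μ) = ⟨χ^μ, χ_ρ⟩ χ^μ(h)`** for every finite-dimensional complex representation
`ρ` of `𝔖ₙ` on `V : Type` and every partition `μ ⊢ n`: the class function `h ↦ tr(ρ(h) P_μ)` has
Fourier coefficient `tr(P_ν P_μ)/χ^ν(1) = δ_{νμ} ⟨χ^μ, χ_ρ⟩` at `χ^ν` (Serre §2.6 Thm. 8 (ii):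
`P_μ` is the projection onto the isotypic component `V_μ`, whose character is `⟨χ^μ, χ_ρ⟩ χ^μ`).
[cite: SerreLinearRepresentations1977, §2.6 Thm. 8] -/
theorem trace_comp_isotypicProj_specht {V : Type} [AddCommGroup V] [Module ℂ V]
    [FiniteDimensional ℂ V] (ρ : Representation ℂ (Equiv.Perm (Fin n)) V) (μ : Nat.Partition n)
    (h : Equiv.Perm (Fin n)) :
    LinearMap.trace ℂ V (ρ h ∘ₗ isotypicProj ρ (spechtCharacter ℂ μ)) =
      classInner (spechtCharacter ℂ μ) ρ.character * spechtCharacter ℂ μ h := by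
  classical
  set P := isotypicProj ρ (spechtCharacter ℂ μ) with hP
  set c := classInner (spechtCharacter ℂ μ) ρ.character with hc
  set ψ : Equiv.Perm (Fin n) → ℂ := fun s => LinearMap.trace ℂ V (ρ s ∘ₗ P) with hψ
  have hcomm : ∀ t, P * ρ t = ρ t * P := fun t =>
    isotypicProj_comm ρ (isClassFun_spechtCharacter μ) t
  -- (1) `ψ` is a class function
  have hcl : IsClassFun ψ := by
    intro s t
    simp only [hψ]
    rw [map_mul, map_mul, ← Module.End.mul_eq_comp, ← Module.End.mul_eq_comp,
      show ρ t * ρ s * ρ t⁻¹ * P = ρ t * (ρ s * ρ t⁻¹ * P) by simp only [mul_assoc],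
      LinearMap.trace_mul_comm, show ρ s * ρ t⁻¹ * P * ρ t = ρ s * (ρ t⁻¹ * (P * ρ t)) by
        simp only [mul_assoc], hcomm t, ← mul_assoc (ρ t⁻¹), ← map_mul, inv_mul_cancel, map_one,
      one_mul]
  -- (2) the Fourier coefficients of `ψ`
  have hcoef : ∀ ν : Nat.Partition n, classInner ψ (spechtCharacter ℂ ν) = if ν = μ then c else 0 := by
    intro ν
    have hsum : ∑ s : Equiv.Perm (Fin n), ψ s * spechtCharacter ℂ ν s⁻¹ =
        LinearMap.trace ℂ V ((∑ s : Equiv.Perm (Fin n), spechtCharacter ℂ ν s⁻¹ • ρ s) * P) := by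
      rw [Finset.sum_mul, map_sum]
      refine Finset.sum_congr rfl fun s _ => ?_
      rw [smul_mul_assoc, map_smul, smul_eq_mul, mul_comm, hψ, Module.End.mul_eq_comp]
    have hne : spechtCharacter ℂ ν 1 / (n.factorial : ℂ) ≠ 0 :=
      div_ne_zero (spechtCharacter_one_ne_zero ν) (Nat.cast_ne_zero.mpr (Nat.factorial_ne_zero n))
    have hW : ∑ s : Equiv.Perm (Fin n), spechtCharacter ℂ ν s⁻¹ • ρ s =
        (spechtCharacter ℂ ν 1 / (n.factorial : ℂ))⁻¹ • isotypicProj ρ (spechtCharacter ℂ ν) := by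
      rw [← smul_sum_spechtCharacter_inv_smul_eq_isotypicProj ρ ν, inv_smul_smul₀ hne]
    rw [classInner_apply, card_perm_fin_cast, hsum, hW, smul_mul_assoc, map_smul, smul_eq_mul]
    by_cases hνμ : ν = μ
    · subst hνμ
      have h1 := spechtCharacter_one_ne_zero ν
      have h2 : (n.factorial : ℂ) ≠ 0 := Nat.cast_ne_zero.mpr (Nat.factorial_ne_zero n)
      rw [if_pos rfl, Module.End.mul_eq_comp, isotypicProj_specht_comp_self, ← hP,
        trace_isotypicProj, ← hc]
      field_simp
    · rw [if_neg hνμ, Module.End.mul_eq_comp, isotypicProj_specht_comp_of_ne ρ hνμ, map_zero,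
        mul_zero, mul_zero]
  -- (3) Fourier expansion of `ψ`, evaluated at `h`
  have hexp := hcl.eq_sum_classInner_smul
  rw [irrChars_toFinset_perm_eq,
    Finset.sum_image fun a _ b _ hab => spechtCharacter_injective hab] at hexp
  have := congr_fun hexp h
  simp only [Finset.sum_apply, Pi.smul_apply, smul_eq_mul, hcoef, ite_mul, zero_mul,
    Finset.sum_ite_eq', Finset.mem_univ, if_true] at this
  exact this

end Trace

/-! ## §2 The abstract Kronecker restriction rule -/

section Abstract

variable {n : ℕ} {V₁ V₂ V : Type} [AddCommGroup V₁] [Module ℂ V₁] [FiniteDimensional ℂ V₁]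
  [AddCommGroup V₂] [Module ℂ V₂] [FiniteDimensional ℂ V₂] [AddCommGroup V] [Module ℂ V]

/-- Isotypic projectors commute with equivariant linear maps between two representations
(`L ρ_f = σ_f L`, Serre §2.6: `P_χ` is a polynomial in the group elements). [folklore] -/
theorem comp_isotypicProj_of_intertwining {W W' : Type*} [AddCommGroup W] [Module ℂ W]
    [AddCommGroup W'] [Module ℂ W'] (σ : Representation ℂ (Equiv.Perm (Fin n)) W)
    (σ' : Representation ℂ (Equiv.Perm (Fin n)) W') (L : W →ₗ[ℂ] W')
    (hL : ∀ g, L ∘ₗ σ g = σ' g ∘ₗ L) (χ : Equiv.Perm (Fin n) → ℂ) :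
    L ∘ₗ isotypicProj σ χ = isotypicProj σ' χ ∘ₗ L := by
  refine LinearMap.ext fun w => ?_
  simp only [LinearMap.coe_comp, Function.comp_apply, isotypicProj_apply, map_sum, map_smul]
  refine Finset.sum_congr rfl fun t _ => ?_
  have h := LinearMap.congr_fun (hL t⁻¹) w
  simp only [LinearMap.coe_comp, Function.comp_apply] at h
  rw [h]

/-- **The Kronecker restriction rule, abstract form.** Let `ρ₁, ρ₂, ρ` be complex
representations of `𝔖ₙ` (`ρ₁, ρ₂` finite-dimensional) and `B : V₁ × V₂ → V` bilinear and
equivariant for the diagonal action, `B(ρ₁(g)x, ρ₂(g)y) = ρ(g)B(x,y)`. If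
`P_λ B(P_μ x, P_ν y) ≠ 0` for some `x, y`, then `g(μ, ν; λ) = dim Hom_{𝔖ₙ}(S^μ ⊗ S^ν, S^λ) ≠ 0`
(CVZ: "the product `P_λ^{V⊗W}(P_μ^V ⊗ P_ν^W)` is nonzero [only] if `g_{λ,μ,ν} ≠ 0`"). Proof: the
commuting idempotents `P_λ^{ρ₁⊗ρ₂}` and `P_μ ⊗ P_ν` on `V₁ ⊗ V₂` have the nonzero idempotent
product `E`, and `tr E = χ^λ(1) ⟨χ^μ,χ_{ρ₁}⟩ ⟨χ^ν,χ_{ρ₂}⟩ g(μ,ν;λ)` by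
`trace_comp_isotypicProj_specht` and the character formula for `g`.
[cite: ChristandlVranaZuiddam2023, §3.1 (before Lemma 3.13)] -/
theorem kroneckerCoeff_ne_zero_of_isotypicProj_bilin (ρ₁ : Representation ℂ (Equiv.Perm (Fin n)) V₁)
    (ρ₂ : Representation ℂ (Equiv.Perm (Fin n)) V₂) (ρ : Representation ℂ (Equiv.Perm (Fin n)) V)
    (B : V₁ →ₗ[ℂ] V₂ →ₗ[ℂ] V) (hB : ∀ (g : Equiv.Perm (Fin n)) (x : V₁) (y : V₂),
      B (ρ₁ g x) (ρ₂ g y) = ρ g (B x y))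
    {lam mu nu : Nat.Partition n} {x : V₁} {y : V₂}
    (h : isotypicProj ρ (spechtCharacter ℂ lam)
      (B (isotypicProj ρ₁ (spechtCharacter ℂ mu) x) (isotypicProj ρ₂ (spechtCharacter ℂ nu) y)) ≠ 0) :
    kroneckerCoeff ℂ mu nu lam ≠ 0 := by
  classical
  set P1 := isotypicProj ρ₁ (spechtCharacter ℂ mu) with hP1
  set P2 := isotypicProj ρ₂ (spechtCharacter ℂ nu) with hP2
  set T : Representation ℂ (Equiv.Perm (Fin n)) (V₁ ⊗[ℂ] V₂) := ρ₁.tprod ρ₂ with hT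
  set PT := isotypicProj T (spechtCharacter ℂ lam) with hPT
  set Q : Module.End ℂ (V₁ ⊗[ℂ] V₂) := TensorProduct.map P1 P2 with hQ
  set L : V₁ ⊗[ℂ] V₂ →ₗ[ℂ] V := TensorProduct.lift B with hLdef
  -- equivariance of `L`
  have hL : ∀ g, L ∘ₗ T g = ρ g ∘ₗ L := fun g => TensorProduct.ext' fun a b => by
    simp only [hLdef, hT, LinearMap.coe_comp, Function.comp_apply, Representation.tprod_apply,
      TensorProduct.map_tmul, TensorProduct.lift.tmul, hB]
  have hLP : L ∘ₗ PT = isotypicProj ρ (spechtCharacter ℂ lam) ∘ₗ L :=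
    comp_isotypicProj_of_intertwining T ρ L hL _
  -- `Q` commutes with the diagonal action, hence with `PT`
  have hQT : ∀ g, Q ∘ₗ T g = T g ∘ₗ Q := fun g => by
    simp only [hQ, hT, Representation.tprod_apply, ← TensorProduct.map_comp]
    congr 1
    · exact isotypicProj_comm ρ₁ (isClassFun_spechtCharacter mu) g
    · exact isotypicProj_comm ρ₂ (isClassFun_spechtCharacter nu) g
  have hQPT : Q * PT = PT * Q := comp_isotypicProj_of_forall_comm T _ hQT
  have hQQ : Q * Q = Q := by
    rw [Module.End.mul_eq_comp, hQ, ← TensorProduct.map_comp, isotypicProj_specht_comp_self,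
      isotypicProj_specht_comp_self]
  have hPP : PT * PT = PT := isotypicProj_specht_comp_self T lam
  -- the idempotent `E`
  set E : Module.End ℂ (V₁ ⊗[ℂ] V₂) := PT * Q with hE
  have hEid : IsIdempotentElem E := by
    change PT * Q * (PT * Q) = PT * Q
    rw [mul_assoc, ← mul_assoc Q PT Q, hQPT, mul_assoc PT Q Q, hQQ, ← mul_assoc, hPP]
  have hEne : E ≠ 0 := by
    intro h0
    apply h
    have key : L (E (x ⊗ₜ[ℂ] y)) = isotypicProj ρ (spechtCharacter ℂ lam) (B (P1 x) (P2 y)) := by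
      have h1 : E (x ⊗ₜ[ℂ] y) = PT (P1 x ⊗ₜ[ℂ] P2 y) := by
        simp only [hE, Module.End.mul_apply, hQ, TensorProduct.map_tmul]
      have h2 := LinearMap.congr_fun hLP (P1 x ⊗ₜ[ℂ] P2 y)
      simp only [LinearMap.coe_comp, Function.comp_apply] at h2
      rw [h1, h2, hLdef, TensorProduct.lift.tmul]
    rw [← key, h0, LinearMap.zero_apply, map_zero]
  have htr : LinearMap.trace ℂ _ E ≠ 0 := fun h0 =>
    hEne ((LinearMap.IsIdempotentElem.trace_eq_zero_iff hEid).1 h0)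
  -- the trace of `E`
  have htrQ : ∀ t : Equiv.Perm (Fin n), LinearMap.trace ℂ _ (T t⁻¹ * Q) =
      (classInner (spechtCharacter ℂ mu) ρ₁.character * spechtCharacter ℂ mu t) *
        (classInner (spechtCharacter ℂ nu) ρ₂.character * spechtCharacter ℂ nu t) := by
    intro t
    rw [Module.End.mul_eq_comp, hT, Representation.tprod_apply, hQ, ← TensorProduct.map_comp,
      LinearMap.trace_tensorProduct', hP1, hP2, trace_comp_isotypicProj_specht,
      trace_comp_isotypicProj_specht,
      Literature.RepresentationTheory.FiniteGroups.spechtCharacter_inv,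
      Literature.RepresentationTheory.FiniteGroups.spechtCharacter_inv]
  have htrE : LinearMap.trace ℂ _ E =
      (spechtCharacter ℂ lam 1 / (n.factorial : ℂ)) *
        (classInner (spechtCharacter ℂ mu) ρ₁.character *
          classInner (spechtCharacter ℂ nu) ρ₂.character) *
        ∑ t : Equiv.Perm (Fin n),
          spechtCharacter ℂ mu t * spechtCharacter ℂ nu t * spechtCharacter ℂ lam t := by
    rw [hE, hPT, isotypicProj, Representation.weightedSum, Finset.sum_mul, map_sum, Finset.mul_sum]
    refine Finset.sum_congr rfl fun t _ => ?_
    rw [smul_mul_assoc, map_smul, smul_eq_mul, htrQ, Pi.smul_apply, smul_eq_mul,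
      card_perm_fin_cast]
    ring
  -- conclude with the character formula for `g`
  intro hg
  apply htr
  rw [htrE, ← kroneckerCoeff_eq_sum_spechtCharacter_holds ℂ mu nu lam, hg, mul_zero, Nat.cast_zero,
    mul_zero]

end Abstract

/-! ## §3 The coordinate statement and the discharge -/

section Coordinates

variable {n : ℕ}

/-- The outer product as a bilinear map. [folklore] -/
def outerPowₗ {ι κ μ ι' κ' μ' : Type*} :
    ((Fin n → ι) → (Fin n → κ) → (Fin n → μ) → ℂ) →ₗ[ℂ]
      ((Fin n → ι') → (Fin n → κ') → (Fin n → μ') → ℂ) →ₗ[ℂ]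
        ((Fin n → ι × ι') → (Fin n → κ × κ') → (Fin n → μ × μ') → ℂ) :=
  LinearMap.mk₂ ℂ outerPow
    (fun u u' v => (isLinearMap_outerPow_left v).map_add u u')
    (fun c u v => (isLinearMap_outerPow_left v).map_smul c u)
    (fun u v v' => (isLinearMap_outerPow_right u).map_add v v')
    (fun c u v => (isLinearMap_outerPow_right u).map_smul c v)

/-- `outerPowₗ u v = outerPow u v`. [folklore] -/
@[simp] theorem outerPowₗ_apply {ι κ μ ι' κ' μ' : Type*}
    (u : (Fin n → ι) → (Fin n → κ) → (Fin n → μ) → ℂ)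
    (v : (Fin n → ι') → (Fin n → κ') → (Fin n → μ') → ℂ) : outerPowₗ u v = outerPow u v := rfl

/-- The Kronecker restriction rule in coordinates, factor 1, alphabets in `Type`.
[cite: ChristandlVranaZuiddam2023, §3.1 (before Lemma 3.13)] -/
theorem kroneckerCoeff_ne_zero_of_isotypicSum₁_outerPow_type {ι κ μ ι' κ' μ' : Type} [Fintype ι]
    [Fintype κ] [Fintype μ] [Fintype ι'] [Fintype κ'] [Fintype μ'] (lam mu nu : Nat.Partition n)
    (u : (Fin n → ι) → (Fin n → κ) → (Fin n → μ) → ℂ)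
    (v : (Fin n → ι') → (Fin n → κ') → (Fin n → μ') → ℂ)
    (h : isotypicSum₁ lam (outerPow (isotypicSum₁ mu u) (isotypicSum₁ nu v)) ≠ 0) :
    kroneckerCoeff ℂ mu nu lam ≠ 0 := by
  refine kroneckerCoeff_ne_zero_of_isotypicProj_bilin (permLegsRep₁ (ι := ι) (κ := κ) (μ := μ))
    (permLegsRep₁ (ι := ι') (κ := κ') (μ := μ')) (permLegsRep₁ (ι := ι × ι') (κ := κ × κ')
    (μ := μ × μ')) outerPowₗ (fun _ _ _ => rfl) (x := u) (y := v) ?_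
  rw [outerPowₗ_apply, isotypicProj_permLegsRep₁, isotypicProj_permLegsRep₁,
    isotypicProj_permLegsRep₁, (isLinearMap_outerPow_left _).map_smul,
    (isLinearMap_outerPow_right _).map_smul, (isLinearMap_isotypicSum₁ lam).map_smul,
    (isLinearMap_isotypicSum₁ lam).map_smul]
  have hc : ∀ l : Nat.Partition n, spechtCharacter ℂ l 1 / (n.factorial : ℂ) ≠ 0 := fun l =>
    div_ne_zero (spechtCharacter_one_ne_zero l) (Nat.cast_ne_zero.mpr (Nat.factorial_ne_zero n))
  exact smul_ne_zero (hc lam) (smul_ne_zero (hc mu) (smul_ne_zero (hc nu) h))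

/-- The Kronecker restriction rule in coordinates, factor 2, alphabets in `Type`.
[cite: ChristandlVranaZuiddam2023, §3.1 (before Lemma 3.13)] -/
theorem kroneckerCoeff_ne_zero_of_isotypicSum₂_outerPow_type {ι κ μ ι' κ' μ' : Type} [Fintype ι]
    [Fintype κ] [Fintype μ] [Fintype ι'] [Fintype κ'] [Fintype μ'] (lam mu nu : Nat.Partition n)
    (u : (Fin n → ι) → (Fin n → κ) → (Fin n → μ) → ℂ)
    (v : (Fin n → ι') → (Fin n → κ') → (Fin n → μ') → ℂ)
    (h : isotypicSum₂ lam (outerPow (isotypicSum₂ mu u) (isotypicSum₂ nu v)) ≠ 0) :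
    kroneckerCoeff ℂ mu nu lam ≠ 0 := by
  refine kroneckerCoeff_ne_zero_of_isotypicProj_bilin (permLegsRep₂ (ι := ι) (κ := κ) (μ := μ))
    (permLegsRep₂ (ι := ι') (κ := κ') (μ := μ')) (permLegsRep₂ (ι := ι × ι') (κ := κ × κ')
    (μ := μ × μ')) outerPowₗ (fun _ _ _ => rfl) (x := u) (y := v) ?_
  rw [outerPowₗ_apply, isotypicProj_permLegsRep₂, isotypicProj_permLegsRep₂,
    isotypicProj_permLegsRep₂, (isLinearMap_outerPow_left _).map_smul,
    (isLinearMap_outerPow_right _).map_smul, (isLinearMap_isotypicSum₂ lam).map_smul,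
    (isLinearMap_isotypicSum₂ lam).map_smul]
  have hc : ∀ l : Nat.Partition n, spechtCharacter ℂ l 1 / (n.factorial : ℂ) ≠ 0 := fun l =>
    div_ne_zero (spechtCharacter_one_ne_zero l) (Nat.cast_ne_zero.mpr (Nat.factorial_ne_zero n))
  exact smul_ne_zero (hc lam) (smul_ne_zero (hc mu) (smul_ne_zero (hc nu) h))

/-- The Kronecker restriction rule in coordinates, factor 3, alphabets in `Type`.
[cite: ChristandlVranaZuiddam2023, §3.1 (before Lemma 3.13)] -/
theorem kroneckerCoeff_ne_zero_of_isotypicSum₃_outerPow_type {ι κ μ ι' κ' μ' : Type} [Fintype ι]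
    [Fintype κ] [Fintype μ] [Fintype ι'] [Fintype κ'] [Fintype μ'] (lam mu nu : Nat.Partition n)
    (u : (Fin n → ι) → (Fin n → κ) → (Fin n → μ) → ℂ)
    (v : (Fin n → ι') → (Fin n → κ') → (Fin n → μ') → ℂ)
    (h : isotypicSum₃ lam (outerPow (isotypicSum₃ mu u) (isotypicSum₃ nu v)) ≠ 0) :
    kroneckerCoeff ℂ mu nu lam ≠ 0 := by
  refine kroneckerCoeff_ne_zero_of_isotypicProj_bilin (permLegsRep₃ (ι := ι) (κ := κ) (μ := μ))
    (permLegsRep₃ (ι := ι') (κ := κ') (μ := μ')) (permLegsRep₃ (ι := ι × ι') (κ := κ × κ')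
    (μ := μ × μ')) outerPowₗ (fun _ _ _ => rfl) (x := u) (y := v) ?_
  rw [outerPowₗ_apply, isotypicProj_permLegsRep₃, isotypicProj_permLegsRep₃,
    isotypicProj_permLegsRep₃, (isLinearMap_outerPow_left _).map_smul,
    (isLinearMap_outerPow_right _).map_smul, (isLinearMap_isotypicSum₃ lam).map_smul,
    (isLinearMap_isotypicSum₃ lam).map_smul]
  have hc : ∀ l : Nat.Partition n, spechtCharacter ℂ l 1 / (n.factorial : ℂ) ≠ 0 := fun l =>
    div_ne_zero (spechtCharacter_one_ne_zero l) (Nat.cast_ne_zero.mpr (Nat.factorial_ne_zero n))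
  exact smul_ne_zero (hc lam) (smul_ne_zero (hc mu) (smul_ne_zero (hc nu) h))

/-- **Discharge of `kroneckerCoeff_ne_zero_of_isotypicSum_outerPow`** (the Kronecker restriction
rule of CVZ §3.1, direction `⇒`, in the coordinates of `QuantumFunctionalsUpper.lean`), in every
universe: re-index the six alphabets into `Type` along `Fintype.equivFin` (the re-indexing is
injective and commutes with `isotypicSumⱼ` and `outerPow`) and apply the `Type` statements.
[cite: ChristandlVranaZuiddam2023, §3.1 (before Lemma 3.13)] -/
theorem kroneckerCoeff_ne_zero_of_isotypicSum_outerPow_holds :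
    kroneckerCoeff_ne_zero_of_isotypicSum_outerPow.{u} := by
  intro ι κ μ ι' κ' μ' _ _ _ _ _ _ n lam mu nu u v
  set eι := Fintype.equivFin ι
  set eκ := Fintype.equivFin κ
  set eμ := Fintype.equivFin μ
  set eι' := Fintype.equivFin ι'
  set eκ' := Fintype.equivFin κ'
  set eμ' := Fintype.equivFin μ'
  refine ⟨fun h => ?_, fun h => ?_, fun h => ?_⟩
  · rw [← reindexPow_ne_zero_iff (eι.prodCongr eι') (eκ.prodCongr eκ') (eμ.prodCongr eμ'),
      reindexPow_isotypicSum₁, reindexPow_outerPow, reindexPow_isotypicSum₁,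
      reindexPow_isotypicSum₁] at h
    exact kroneckerCoeff_ne_zero_of_isotypicSum₁_outerPow_type lam mu nu _ _ h
  · rw [← reindexPow_ne_zero_iff (eι.prodCongr eι') (eκ.prodCongr eκ') (eμ.prodCongr eμ'),
      reindexPow_isotypicSum₂, reindexPow_outerPow, reindexPow_isotypicSum₂,
      reindexPow_isotypicSum₂] at h
    exact kroneckerCoeff_ne_zero_of_isotypicSum₂_outerPow_type lam mu nu _ _ h
  · rw [← reindexPow_ne_zero_iff (eι.prodCongr eι') (eκ.prodCongr eκ') (eμ.prodCongr eμ'),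
      reindexPow_isotypicSum₃, reindexPow_outerPow, reindexPow_isotypicSum₃,
      reindexPow_isotypicSum₃] at h
    exact kroneckerCoeff_ne_zero_of_isotypicSum₃_outerPow_type lam mu nu _ _ h

end Coordinates

end Literature.Computability.AlgebraicComplexity

end
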